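import Mathlib
import HarnessLib
import Summits.NavierStokesRegularity.NavierStokesRegularity.Theorems.HalfSpaceWindowDoorCirculationCarryingRigidityLogEnergy
import Summits.NavierStokesRegularity.NavierStokesRegularity.Theorems.HalfSpaceWindowDoorCirculationCarryingRigidityConeFluxSubsolution
import Summits.NavierStokesRegularity.NavierStokesRegularity.Theorems.SymmetryModuliCountFarPastLedger
import Summits.NavierStokesRegularity.NavierStokesRegularity.Theorems.PoloidalWindowDoorPoloidalWindowRigidityWindow

/-!
# Route `HalfSpaceWindowDoor`, crux `CirculationCarryingRigidity` (stmt-NavierStokesRegularity-25311) — census row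
# «NO COLUMNAR VORTEX»: the far-past ENERGY LEDGER of the door class (crux `SymmetryModuliCount.FarPastLedger`, PROVED,
# `∫_{B_R(x₀)}‖v(t)‖² ≤ K(C)·R`) against the closed-hemisphere sign

LEAD ns-hsw-p1 g12 (cell pub-ns-dss), `--supports stmt-NavierStokesRegularity-25311 --as helper`; line `ledger`.

THE NEW INPUT.  Every profile of the route's Type-I ancient Oseen-mild class («door class», `InDoorClass C v`: time-only rate
`‖v(t,·)‖ ≤ C/√(−t)`, continuity, the unit-viscosity Oseen–Duhamel identity, divergence-free slices) is a member of the tree's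
`IsTypeIAncientMild C` (`isTypeIAncientMild_of_class`), and for that class the FAR-PAST ENERGY LEDGER AT THE LERAY RATE is a
THEOREM of the tree (`Theorems.FarPastLedger_proof`, item stmt-NavierStokesRegularity-14060, closed `proved`):
`∫_{B_R(x₀)} ‖v(t,x)‖² dx ≤ K(C) · R` for all `t < 0`, all centres `x₀`, all radii `R > 0`.  None of the 150-odd census files of
this crux (lines `extremal` … `rot_bernoulli`) uses it: they spend only the pointwise rate `C/√(−t)` (and, in sub-classes, the
space–time / axis-Type-I bounds).  The ledger is SCALE-INVARIANT and it is exactly the planar `L²`-control that the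
closed-hemisphere sign converts into circulation control:

THE MECHANISM (companion file `…CirculationCarryingRigidityLogEnergy`: point-vortex energy is logarithmically divergent).  With
`ω₃ = ⟪curl v, e₃⟫ ≥ 0` the disc circulation `Γ(r,c,s) = ∮_{S(r,c)} v·e_θ dl` about the vertical axis is non-negative and
non-decreasing in `r`, and `r∫₀^{2π}‖v(s)(r,θ,c)‖²dθ ≥ Γ(r,c,s)²/(2πr)` on every circle; hence on ONE plane
`∫_{ρ<|ξ|<R} ‖v(s)(ξ,c)‖² dξ ≥ Γ(ρ,c,s)² · log(R/ρ)/(2π)` (`…LogEnergy.annulusEnergy_ge`), and stacking the planes `|c − z₀| < R`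
(the cylinder lies in the ball `B((0,0,z₀), 2R)`, `…LogEnergy.integral_circ_sq_mul_log_le_ball`)
`(log(R/ρ)/2π) · ∫_{|c−z₀|<R} Γ(ρ,c,s)² dc ≤ ∫_{B((0,0,z₀),2R)} ‖v(s)‖² ≤ 2K R`.

RESULTS (all axes by translation covariance `…MovingFrame.inDoorClass_translate` / `signE3_translate`; stated about the `e₃`-axis).
* `exists_ledger` — the ledger constant `K(C) ≥ 0` of the door class (transport of `Theorems.FarPastLedger_proof`).
* `exists_circ_sq_integral_mul_log_le` — **RMS CIRCULATION LAW**: door class + sign ⇒ for all `s < 0`, `0 < ρ < R`, `z₀`: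
  `(∫_{(z₀−R, z₀+R)} Γ(ρ,c,s)² dc) · log(R/ρ) ≤ 4π K(C) R`.  The height-rms of the tube circulation over a window of `2R` planes is
  `≤ (2πK/log(R/ρ))^{1/2} → 0` as `R/ρ → ∞`: scale-invariant, uniform in the profile (only `C` enters), in `s`, in the axis.
* `exists_volume_circ_ge_mul_log_le` — Chebyshev form: in a window of `2R` planes the heights whose disc `D(ρ)` carries `Γ ≥ γ`
  have measure `≤ 4πKR/(γ² log(R/ρ))` (density `→ 0`).
* `exists_circ_lt_above` / `exists_circ_lt_below` / `frequently_circ_lt` — **TUBE PINCHING**: door class + sign ⇒ for every `s<0`,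
  `ρ>0`, `γ>0` there are heights `c → +∞` AND `c → −∞` with `Γ(ρ,c,s) < γ` (indeed `{c : Γ(ρ,c,s) ≥ γ}` has upper density
  `≤ 2πK/(γ² log(R/ρ))` in windows of size `2R`).
* `not_columnar` / `not_columnar'` — **CENSUS THEOREM (the COLUMNAR stratum is EMPTY)**: no closed-hemisphere door-class profile
  has, at any time `s < 0` and radius `ρ > 0`, its tube circulation bounded below along the whole axis (`inf_c Γ(ρ,c,s) > 0`); with
  the verbatim hypotheses of `HemisphereLiouvilleE3`.

CENSUS READING.  The route text describes the enemy of the crux as «a collapsing non-symmetric swirling vortex with monotone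
circulation» — a COLUMN; the time-only rows (`…TimeOnly*`, `…AnnularMean`, `…PlanarEnergy`) leave alive exactly the profiles with a
height-uniform point-vortex tail `|v_h| ≳ Φ₀/(2π|x_h|)` (Mestel far field), and the axis-Type-I rows (`…TiltDominatedLiouville`,
`…EddyTorque*`) the circulation-carrying LINE vortex `Γ(ρ,c,s) ≥ γ > 0 ∀c`.  All of these are DEAD in the door class itself: the enemy
of W6 = `HemisphereLiouvilleE3` is a collapsing BLOB (or a necklace of blobs) whose vertical-vorticity flux pinches along every
vertical axis at every scale — quantitatively, in every window of `2R` consecutive planes the disc `D(ρ)` carries rms circulation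
`≤ (2πK(C)/log(R/ρ))^{1/2}`.  No eddy / cone / inflow hypothesis, no space–time bound; the dynamics enters only through the ledger.

WHAT THIS IS NOT: not a statement about Navier–Stokes regularity (Clay A); door statements are regularity CRITERIA about
HYPOTHETICAL blow-up profiles (KNSS ancient mild solutions); item 25311 stays OPEN at its research stub `stub_layerExclusion`.
-/

noncomputable section

-- the summit and its single sub-problem share the name (CONVENTIONS §1), as in every Theorems file
set_option linter.dupNamespace false

namespace Summit.NavierStokesRegularity.NavierStokesRegularity.Theorems.HalfSpaceWindowDoorCirculationCarryingRigidityLedger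

open Set Function Filter MeasureTheory Topology intervalIntegral Metric
open scoped InnerProductSpace RealInnerProductSpace
open Literature.Analysis Literature.Analysis.FluidPDE
open Summit.NavierStokesRegularity.NavierStokesRegularity.Theorems.HalfSpaceWindowDoorCirculationCarryingRigidityDefs
  (planePt InDoorClass)
open Summit.NavierStokesRegularity.NavierStokesRegularity.Theorems.AxisTwistDoorAveragedConeLiouvilleDefs (cylPt eT circ SignE3)
open Summit.NavierStokesRegularity.NavierStokesRegularity.Theorems.HalfSpaceWindowDoorCirculationCarryingRigidityConeFluxSubsolution
  (contDiff_one_slice)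
open Summit.NavierStokesRegularity.NavierStokesRegularity.Theorems.PoloidalWindowDoorPoloidalWindowRigidityWindow
  (isTypeIAncientMild_of_class)
open Summit.NavierStokesRegularity.NavierStokesRegularity.Theorems.HalfSpaceWindowDoorCirculationCarryingRigidityLogEnergy
  (circ_sq_integral_mul_log_le mul_le_integral_circ_sq)
open Summit.NavierStokesRegularity.NavierStokesRegularity.Theorems.HalfSpaceWindowDoorCirculationCarryingRigidityPlanarEnergy
  (continuous_circ_height)

variable {v : ℝ → EuclideanSpace ℝ (Fin 3) → EuclideanSpace ℝ (Fin 3)}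

/-! ### §3  The far-past energy ledger of the door class, and the RMS CIRCULATION LAW -/

/-- **THE LEDGER CONSTANT OF THE DOOR CLASS.**  For every Type-I constant `C` there is `K = K(C) ≥ 0` such that every door-class
profile `v` (`InDoorClass C v`) satisfies `∫_{B_R(x₀)} ‖v(t,x)‖² dx ≤ K·R` for all `t < 0`, `x₀`, `R > 0` — the tree theorem
`Theorems.FarPastLedger_proof` (crux stmt-NavierStokesRegularity-14060 of route SymmetryModuliCount) transported along
`isTypeIAncientMild_of_class`. -/
theorem exists_ledger (C : ℝ) : ∃ K : ℝ, 0 ≤ K ∧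
    ∀ v : ℝ → EuclideanSpace ℝ (Fin 3) → EuclideanSpace ℝ (Fin 3), InDoorClass C v →
      ∀ t < 0, ∀ (x₀ : EuclideanSpace ℝ (Fin 3)) (R : ℝ), 0 < R → ∫ x in ball x₀ R, ‖v t x‖ ^ 2 ≤ K * R := by
  obtain ⟨K, hK⟩ := Summit.NavierStokesRegularity.NavierStokesRegularity.Theorems.FarPastLedger_proof C
  refine ⟨max K 0, le_max_right _ _, fun v hv t ht x₀ R hR => ?_⟩
  have hA : IsTypeIAncientMild C v := isTypeIAncientMild_of_class hv.1 hv.2.1 hv.2.2.1 hv.2.2.2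
  exact (hK v hA t ht x₀ R hR).trans (mul_le_mul_of_nonneg_right (le_max_left _ _) hR.le)

/-- **RMS CIRCULATION LAW (door class + closed hemisphere).**  For every Type-I constant `C` there is `K = K(C) ≥ 0` such that
every closed-hemisphere door-class profile satisfies, for all `s < 0`, `0 < ρ < R` and heights `z₀`:
`(∫_{(z₀−R, z₀+R)} Γ(ρ,c,s)² dc) · log(R/ρ) ≤ 4π K R`.
In words: over any window of `2R` consecutive horizontal planes the root-mean-square circulation of the discs `D(ρ, c)` about the
axis is at most `(2πK(C)/log(R/ρ))^{1/2}` — it tends to `0` as `R/ρ → ∞`, uniformly in the profile, the time and the window. -/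
theorem exists_circ_sq_integral_mul_log_le (C : ℝ) : ∃ K : ℝ, 0 ≤ K ∧
    ∀ v : ℝ → EuclideanSpace ℝ (Fin 3) → EuclideanSpace ℝ (Fin 3), InDoorClass C v → SignE3 v →
      ∀ s < 0, ∀ ρ R : ℝ, 0 < ρ → ρ < R → ∀ z₀ : ℝ,
        (∫ c in Ioo (z₀ - R) (z₀ + R), circ v ρ c s ^ 2) * Real.log (R / ρ) ≤ 4 * Real.pi * K * R := by
  obtain ⟨K, hK0, hK⟩ := exists_ledger C
  exact ⟨K, hK0, fun v hv hsign s hs ρ R hρ hρR z₀ =>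
    circ_sq_integral_mul_log_le hs (contDiff_one_slice hv hs) hsign (fun x₀ r hr => hK v hv s hs x₀ r hr) hρ hρR z₀⟩

/-- **DENSITY OF LOADED PLANES (Chebyshev form of the rms law).**  With `K = K(C)` as above: for `0 < ρ < R`, `γ > 0` and any
window of `2R` consecutive planes, the set of heights whose disc `D(ρ,c)` carries circulation `≥ γ` has measure
`≤ 4πKR / (γ² log(R/ρ))` — its DENSITY in the window is `≤ 2πK/(γ² log(R/ρ)) → 0` as `R/ρ → ∞`. -/
theorem exists_volume_circ_ge_mul_log_le (C : ℝ) : ∃ K : ℝ, 0 ≤ K ∧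
    ∀ v : ℝ → EuclideanSpace ℝ (Fin 3) → EuclideanSpace ℝ (Fin 3), InDoorClass C v → SignE3 v →
      ∀ s < 0, ∀ ρ R : ℝ, 0 < ρ → ρ < R → ∀ γ : ℝ, 0 < γ → ∀ z₀ : ℝ,
        γ ^ 2 * volume.real {c : ℝ | c ∈ Ioo (z₀ - R) (z₀ + R) ∧ γ ≤ circ v ρ c s} * Real.log (R / ρ) ≤
          4 * Real.pi * K * R := by
  obtain ⟨K, hK0, hK⟩ := exists_circ_sq_integral_mul_log_le C
  refine ⟨K, hK0, fun v hv hsign s hs ρ R hρ hρR γ hγ z₀ => ?_⟩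
  have hmain := hK v hv hsign s hs ρ R hρ hρR z₀
  have hvc : Continuous (v s) := (contDiff_one_slice hv hs).continuous
  set I : Set ℝ := Ioo (z₀ - R) (z₀ + R) with hI
  -- Chebyshev on the window for `f = Γ²`
  have hfi : Integrable (fun c => circ v ρ c s ^ 2) (volume.restrict I) :=
    (((continuous_circ_height hvc ρ).pow 2).continuousOn.integrableOn_compact isCompact_Icc).mono_set Ioo_subset_Icc_self
  have hcheb := mul_meas_ge_le_integral_of_nonneg (μ := volume.restrict I)
    (Eventually.of_forall fun c => sq_nonneg (circ v ρ c s)) hfi (γ ^ 2)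
  -- `{γ ≤ Γ} ⊆ {γ² ≤ Γ²}` and the restricted measure of the former is the measure of the window set
  have hsub : volume.real {c : ℝ | c ∈ I ∧ γ ≤ circ v ρ c s} ≤ (volume.restrict I).real {c | γ ^ 2 ≤ circ v ρ c s ^ 2} := by
    rw [measureReal_restrict_apply' measurableSet_Ioo]
    refine measureReal_mono (fun c hc => ⟨pow_le_pow_left₀ hγ.le hc.2 2, hc.1⟩) ?_
    exact ((measure_mono Set.inter_subset_right).trans_lt
      (by rw [Real.volume_Ioo]; exact ENNReal.ofReal_lt_top)).ne
  have hlog : 0 ≤ Real.log (R / ρ) := Real.log_nonneg ((one_le_div hρ).2 hρR.le)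
  calc γ ^ 2 * volume.real {c : ℝ | c ∈ I ∧ γ ≤ circ v ρ c s} * Real.log (R / ρ)
      ≤ γ ^ 2 * (volume.restrict I).real {c | γ ^ 2 ≤ circ v ρ c s ^ 2} * Real.log (R / ρ) := by gcongr
    _ ≤ (∫ c in I, circ v ρ c s ^ 2) * Real.log (R / ρ) := mul_le_mul_of_nonneg_right hcheb hlog
    _ ≤ 4 * Real.pi * K * R := hmain

/-! ### §4  TUBE PINCHING: the circulation of a fixed disc is small on most far planes -/

/-- **PINCHING ABOVE.**  Door class + closed hemisphere: for every `s < 0`, `ρ > 0`, `γ > 0` and every height `Z` there is a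
plane ABOVE `Z` through which the disc of radius `ρ` carries circulation `< γ`. -/
theorem exists_circ_lt_above {C : ℝ} (hv : InDoorClass C v) (hsign : SignE3 v) {s : ℝ} (hs : s < 0)
    {ρ : ℝ} (hρ : 0 < ρ) {γ : ℝ} (hγ : 0 < γ) (Z : ℝ) : ∃ c : ℝ, Z ≤ c ∧ circ v ρ c s < γ := by
  by_contra hcon
  push Not at hcon
  obtain ⟨K, hK0, hK⟩ := exists_ledger C
  -- radius `R = ρ · exp(2πK/γ² + 1) > ρ`
  set L : ℝ := 2 * Real.pi * K / γ ^ 2 + 1 with hL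
  have hL0 : 0 < L := by positivity
  set R : ℝ := ρ * Real.exp L with hRdef
  have hρR : ρ < R := by
    have : 1 < Real.exp L := Real.one_lt_exp_iff.2 hL0
    calc ρ = ρ * 1 := (mul_one ρ).symm
      _ < ρ * Real.exp L := mul_lt_mul_of_pos_left this hρ
  have hR : 0 < R := hρ.trans hρR
  have hlog : Real.log (R / ρ) = L := by
    rw [hRdef, mul_div_cancel_left₀ (Real.exp L) hρ.ne', Real.log_exp]
  -- window `(Z, Z + 2R)`, centre `z₀ = Z + R`
  have hmain := circ_sq_integral_mul_log_le hs (contDiff_one_slice hv hs) hsign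
    (fun x₀ r hr => hK v hv s hs x₀ r hr) hρ hρR (Z + R)
  have hwin : γ ^ 2 * (2 * R) ≤ ∫ c in Ioo (Z + R - R) (Z + R + R), circ v ρ c s ^ 2 := by
    have h := mul_le_integral_circ_sq (ρ := ρ) (a := Z + R - R) (b := Z + R + R) (contDiff_one_slice hv hs).continuous
      (by linarith) hγ.le fun c hc => hcon c (by linarith [hc.1])
    have e : Z + R + R - (Z + R - R) = 2 * R := by ring
    rwa [e] at h
  rw [hlog] at hmain
  -- `γ²·2R·L ≤ 4πKR`, i.e. `γ² L ≤ 2πK`, contradicting `L = 2πK/γ² + 1`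
  have h4 : γ ^ 2 * (2 * R) * L ≤ 4 * Real.pi * K * R := (mul_le_mul_of_nonneg_right hwin hL0.le).trans hmain
  have h5 : γ ^ 2 * L ≤ 2 * Real.pi * K := by
    have h4' : (γ ^ 2 * L) * (2 * R) ≤ (2 * Real.pi * K) * (2 * R) := by nlinarith
    exact le_of_mul_le_mul_right h4' (by positivity)
  have h6 : γ ^ 2 * L = 2 * Real.pi * K + γ ^ 2 := by
    rw [hL]; field_simp
  nlinarith [pow_pos hγ 2]

/-- **PINCHING BELOW** (the mirror statement: a plane BELOW any height with small disc circulation). -/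
theorem exists_circ_lt_below {C : ℝ} (hv : InDoorClass C v) (hsign : SignE3 v) {s : ℝ} (hs : s < 0)
    {ρ : ℝ} (hρ : 0 < ρ) {γ : ℝ} (hγ : 0 < γ) (Z : ℝ) : ∃ c : ℝ, c ≤ Z ∧ circ v ρ c s < γ := by
  by_contra hcon
  push Not at hcon
  obtain ⟨K, hK0, hK⟩ := exists_ledger C
  set L : ℝ := 2 * Real.pi * K / γ ^ 2 + 1 with hL
  have hL0 : 0 < L := by positivity
  set R : ℝ := ρ * Real.exp L with hRdef
  have hρR : ρ < R := by
    have : 1 < Real.exp L := Real.one_lt_exp_iff.2 hL0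
    calc ρ = ρ * 1 := (mul_one ρ).symm
      _ < ρ * Real.exp L := mul_lt_mul_of_pos_left this hρ
  have hR : 0 < R := hρ.trans hρR
  have hlog : Real.log (R / ρ) = L := by
    rw [hRdef, mul_div_cancel_left₀ (Real.exp L) hρ.ne', Real.log_exp]
  have hmain := circ_sq_integral_mul_log_le hs (contDiff_one_slice hv hs) hsign
    (fun x₀ r hr => hK v hv s hs x₀ r hr) hρ hρR (Z - R)
  have hwin : γ ^ 2 * (2 * R) ≤ ∫ c in Ioo (Z - R - R) (Z - R + R), circ v ρ c s ^ 2 := by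
    have h := mul_le_integral_circ_sq (ρ := ρ) (a := Z - R - R) (b := Z - R + R) (contDiff_one_slice hv hs).continuous
      (by linarith) hγ.le fun c hc => hcon c (by linarith [hc.2])
    have e : Z - R + R - (Z - R - R) = 2 * R := by ring
    rwa [e] at h
  rw [hlog] at hmain
  have h4 : γ ^ 2 * (2 * R) * L ≤ 4 * Real.pi * K * R := (mul_le_mul_of_nonneg_right hwin hL0.le).trans hmain
  have h5 : γ ^ 2 * L ≤ 2 * Real.pi * K := by
    have h4' : (γ ^ 2 * L) * (2 * R) ≤ (2 * Real.pi * K) * (2 * R) := by nlinarith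
    exact le_of_mul_le_mul_right h4' (by positivity)
  have h6 : γ ^ 2 * L = 2 * Real.pi * K + γ ^ 2 := by
    rw [hL]; field_simp
  nlinarith [pow_pos hγ 2]

/-- **TUBE PINCHING, filter form**: along `c → +∞` and along `c → −∞` the disc circulation `Γ(ρ,c,s)` is FREQUENTLY below every
`γ > 0` (and it is `≥ 0` everywhere: `liminf = 0` in both directions). -/
theorem frequently_circ_lt {C : ℝ} (hv : InDoorClass C v) (hsign : SignE3 v) {s : ℝ} (hs : s < 0)
    {ρ : ℝ} (hρ : 0 < ρ) {γ : ℝ} (hγ : 0 < γ) :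
    (∃ᶠ c in atTop, circ v ρ c s < γ) ∧ (∃ᶠ c in atBot, circ v ρ c s < γ) :=
  ⟨Filter.frequently_atTop.2 fun Z => exists_circ_lt_above hv hsign hs hρ hγ Z,
    Filter.frequently_atBot.2 fun Z => exists_circ_lt_below hv hsign hs hρ hγ Z⟩

/-! ### §5  CENSUS THEOREM: the columnar stratum of W6 is empty -/

/-- **NO COLUMNAR VORTEX (bundled form).**  A closed-hemisphere door-class profile never has its tube circulation bounded below
along the whole axis: for every `s < 0`, `ρ > 0`, `γ > 0` some plane carries `Γ(ρ,c,s) < γ` (so `inf_c Γ(ρ,c,s) = 0`, `Γ ≥ 0`). -/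
theorem not_columnar {C : ℝ} (hv : InDoorClass C v) (hsign : SignE3 v) {s : ℝ} (hs : s < 0) {ρ : ℝ} (hρ : 0 < ρ)
    {γ : ℝ} (hγ : 0 < γ) : ∃ c : ℝ, circ v ρ c s < γ := by
  obtain ⟨c, -, hc⟩ := exists_circ_lt_above hv hsign hs hρ hγ (0 : ℝ)
  exact ⟨c, hc⟩

/-- **CENSUS THEOREM «NO COLUMNAR VORTEX», verbatim hypotheses of `HemisphereLiouvilleE3`.**  A profile of the route's Type-I
ancient Oseen-mild class (rate `‖v(t,·)‖ ≤ C/√(−t)`, continuity on the open lower slab, unit-viscosity Oseen–Duhamel identity between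
negative times, divergence-free slices) with `⟪curl v(s), e₃⟫ ≥ 0` everywhere has, for every time `s < 0`, radius `ρ > 0` and level
`γ > 0`, horizontal planes arbitrarily far UP and arbitrarily far DOWN through which the disc `D(ρ)` about the vertical axis carries
circulation `Γ(ρ,c,s) = ∮_{S(ρ,c)} v·e_θ dl < γ`.  (All vertical axes: translate by `…MovingFrame.inDoorClass_translate` /
`signE3_translate`.)  The circulation-carrying COLUMN — the collapsing line vortex with `inf_c Γ(ρ,c,s) > 0` — is not in the class. -/
theorem not_columnar' (C : ℝ) (v : ℝ → EuclideanSpace ℝ (Fin 3) → EuclideanSpace ℝ (Fin 3))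
    (hrate : HasTypeITimeDecay C v)
    (hcont : ContinuousOn (uncurry v) (Iio (0 : ℝ) ×ˢ univ))
    (hmild : ∀ s t : ℝ, s < t → t < 0 → ∀ x,
      v t x = UnboundedOperators.heatExtension (v s) (t - s) x - oseenDuhamel 1 s v v t x)
    (hdiv : ∀ t < 0, VectorCalculus.IsDivFree (v t))
    (hsign : ∀ s < 0, ∀ y, 0 ≤ ⟪curl (v s) y, (EuclideanSpace.single (2 : Fin 3) (1 : ℝ))⟫_ℝ) :
    ∀ s < 0, ∀ ρ > 0, ∀ γ > 0, ∀ Z : ℝ,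
      (∃ c : ℝ, Z ≤ c ∧ circ v ρ c s < γ) ∧ (∃ c : ℝ, c ≤ Z ∧ circ v ρ c s < γ) :=
  fun _ hs _ hρ _ hγ Z =>
    ⟨exists_circ_lt_above ⟨hrate, hcont, hmild, hdiv⟩ hsign hs hρ hγ Z,
      exists_circ_lt_below ⟨hrate, hcont, hmild, hdiv⟩ hsign hs hρ hγ Z⟩

/-! ### Appendix (same seat, g12): log-free readings of the rms law -/

/-- **FINITE RMS CIRCULATION AT EVERY SCALE (door class + closed hemisphere).**  With `K = K(C)` of the rms law: for all `s < 0`,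
`R > 0`, `z₀`:  `∫_{(z₀−R, z₀+R)} Γ(R/3, c, s)² dc ≤ 4π K R` — the root-mean-square, over any window of `2R` consecutive planes, of the
circulation of the discs of radius `R/3` about the axis is `≤ (2πK(C))^{1/2}`, a constant of the class, at EVERY scale `R` (in the
time-only class only the pointwise Stokes bound `Γ(R/3,c,s) ≤ (2π/3)·R·C/√(−s)`, unbounded in `R`, was available). -/
theorem exists_circ_sq_integral_le (C : ℝ) : ∃ K : ℝ, 0 ≤ K ∧
    ∀ v : ℝ → EuclideanSpace ℝ (Fin 3) → EuclideanSpace ℝ (Fin 3), InDoorClass C v → SignE3 v →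
      ∀ s < 0, ∀ R > 0, ∀ z₀ : ℝ, ∫ c in Ioo (z₀ - R) (z₀ + R), circ v (R / 3) c s ^ 2 ≤ 4 * Real.pi * K * R := by
  obtain ⟨K, hK0, hK⟩ := exists_circ_sq_integral_mul_log_le C
  refine ⟨K, hK0, fun v hv hsign s hs R hR z₀ => ?_⟩
  have h := hK v hv hsign s hs (R / 3) R (by positivity) (by linarith) z₀
  have hlog : (1 : ℝ) ≤ Real.log (R / (R / 3)) := by
    have e : R / (R / 3) = 3 := by field_simp
    rw [e, ← Real.log_exp 1]
    refine Real.log_le_log (Real.exp_pos 1) ?_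
    have h3 := Real.exp_one_lt_d9
    linarith
  have hI : 0 ≤ ∫ c in Ioo (z₀ - R) (z₀ + R), circ v (R / 3) c s ^ 2 :=
    setIntegral_nonneg measurableSet_Ioo fun c _ => sq_nonneg _
  calc ∫ c in Ioo (z₀ - R) (z₀ + R), circ v (R / 3) c s ^ 2
      = (∫ c in Ioo (z₀ - R) (z₀ + R), circ v (R / 3) c s ^ 2) * 1 := (mul_one _).symm
    _ ≤ (∫ c in Ioo (z₀ - R) (z₀ + R), circ v (R / 3) c s ^ 2) * Real.log (R / (R / 3)) :=
        mul_le_mul_of_nonneg_left hlog hI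
    _ ≤ 4 * Real.pi * K * R := h

/-- **CONICAL PINCHING (log-free density form).**  With `K = K(C)`: for every opening `θ ∈ (0,1)`, scale `R > 0`, level `γ > 0`, time
`s < 0` and window centre `z₀`, the heights `c ∈ (z₀−R, z₀+R)` whose disc of radius `θR` carries circulation `≥ γ` have measure
`≤ 4πKR/(γ² log(1/θ))` — to hold circulation `γ` on a positive fraction `δ` of the planes of a window, the flux tube must be wider than the
cone of opening `θ = exp(−2πK/(γ²δ))` (rms over the window, uniformly in the scale). -/
theorem exists_volume_circ_ge_cone_le (C : ℝ) : ∃ K : ℝ, 0 ≤ K ∧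
    ∀ v : ℝ → EuclideanSpace ℝ (Fin 3) → EuclideanSpace ℝ (Fin 3), InDoorClass C v → SignE3 v →
      ∀ s < 0, ∀ θ R : ℝ, 0 < θ → θ < 1 → 0 < R → ∀ γ : ℝ, 0 < γ → ∀ z₀ : ℝ,
        γ ^ 2 * volume.real {c : ℝ | c ∈ Ioo (z₀ - R) (z₀ + R) ∧ γ ≤ circ v (θ * R) c s} * Real.log (1 / θ) ≤
          4 * Real.pi * K * R := by
  obtain ⟨K, hK0, hK⟩ := exists_volume_circ_ge_mul_log_le C
  refine ⟨K, hK0, fun v hv hsign s hs θ R hθ hθ1 hR γ hγ z₀ => ?_⟩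
  have h := hK v hv hsign s hs (θ * R) R (by positivity) (by nlinarith) γ hγ z₀
  have e : R / (θ * R) = 1 / θ := by
    field_simp
  rwa [e] at h

end Summit.NavierStokesRegularity.NavierStokesRegularity.Theorems.HalfSpaceWindowDoorCirculationCarryingRigidityLedger

end
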